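import Summits.QuantumFields.YangMills.Theorems.BalabanUVNodesN13NormalisationNoGoCouplingBlindAtRecord13SepCoPHV
import Summits.QuantumFields.YangMills.Theorems.BalabanUVNodesK2R9Holds

/-!
# BalabanUVNodes ∕ N13 — K1⁹'s WITNESS CANNOT BE COUPLING-BLIND: at every tuple `(θ, h, v)` whose normalisation inputs are coupling-blind (e.g. the K0-class `Efl = logz = 0`),
# the BODY of the deciding crux `StabilityBRunRowsAtRecordR13SepCoPHV` (stmt-QuantumFields-27364) is FALSE — K2⁹ by name supplies END from the rows

(Track A, DAG node N13 = [B16]; cluster K1 — helper for K1⁹ stmt-QuantumFields-27364; seat `pub-ymgap-dag-n13-w3` g5; 2026-08-28; count-neutral; theses cone: imports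
`…Theorems.BalabanUVNodesK2R9Holds`.)  Third file: the cone-side reading of `…N13NormalisationNoGoCouplingBlindAtRecord13SepCoPHV.false_of_endStatementBPrinted_of_endpointExistence_of_couplingBlind`.
K1⁹'s body at `(θ, h, v)` (the text after `∃ θ h v,` of the route decl, VERBATIM) carries (B) at the revised datum AND the run rows (i)(iv)(C) + window, and K2⁹ `endpointGivenRunRowsR13SepCoPHV_holds`
(ym-nodeO DEF-1 ∕ dag-n24's END theorem by name) turns the rows into `DagBinding.EndpointExistence`; the no-go then fires.  So: ★★★ `k1R9Body_false_of_couplingBlind`, its K0-class instance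
`k1R9Body_false_of_logz_zero_Efl_zero`, and the reading for suppliers `k1R9Witness_not_logz_zero_Efl_zero`: whatever tuple closes K1⁹, its `logz ∕ Efl` are NOT both zero (indeed violate
coupling-blindness for every constant) — the witness's normalisation must carry print's coupling-dependent `log z_j ≈ d(𝔤) log g_j` ([I] (0.15); tree `B16ZLower`).
CONSEQUENCE FOR THE LANES (located, count-neutral): the K0-class Stage-13 witnesses of record (`Node00.Record8Inhabited` :200, `Record12Numerics` :247, `Record12NumericsFamilyDict` :113 — all
`Efl := 0, logz := 0`) cannot be K1⁹'s witness as they stand; any closing template for K1⁹ that pins `θ.Efl ≡ 0 ∧ θ.logz ≡ 0` at the witness has an unsatisfiable antecedent.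
HONEST FRAMING: count-neutral; K1⁹ NEITHER proved NOR refuted (its `∃ θ` ranges over ALL normalisation slots — only the coupling-blind class is excluded); nothing of Bałaban's asserted or refuted; no
skeleton ∕ route text changed; N13 NOT discharged; counts UNMOVED (typed 28∕28 · discharged 5∕27 · A 5∕28); R4 closes the conditional finite-𝕋⁴ rung `BalabanLadder.UV` only — the Yang–Mills
mass gap (Clay) is NOT proved by any of this; nothing continuum ∕ ℝ⁴ ∕ OS.  No `sorry`, `def`, `instance`, `notation`.
-/

noncomputable section

open scoped BigOperators

namespace Summit.QuantumFields.YangMills.BalabanUVNodes.N13K1R9WitnessNotCouplingBlind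

open Literature.MathematicalPhysics.QuantumFieldTheory.Balaban1983to89
open Literature.MathematicalPhysics.QuantumFieldTheory.Balaban1983to89.T4Continuum
open Literature.MathematicalPhysics.QuantumFieldTheory.Balaban1983to89.Node00
open Summit.QuantumFields.YangMills.Theorems.BalabanUVNodesK2R9Holds (endpointGivenRunRowsR13SepCoPHV_holds)
open Summit.QuantumFields.YangMills.BalabanUVNodes.N13NormalisationNoGoCouplingBlindAtRecord13SepCoPHV
  (false_of_endStatementBPrinted_of_endpointExistence_of_couplingBlind)

variable {F : T4Family}

/-- **★★★ K1⁹'s BODY IS FALSE AT EVERY COUPLING-BLIND TUPLE.**  For `θ h v` with `−logz_p(j)·(L⁴−1)|T₁^{(j+1)}| + Efl_p(j) ≤ C_w·|T^{(j)*|}` (`j < p.K`, one `C_w ≥ 0`): the text after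
`∃ θ h v,` of `Summit.QuantumFields.YangMills.Theses.BalabanUVNodes.StabilityBRunRowsAtRecordR13SepCoPHV`, VERBATIM, implies `False` — K2⁹ BY NAME gives END from the rows + window, and the
no-go of `…N13NormalisationNoGoCouplingBlindAtRecord13SepCoPHV` fires on (B) + END. [cite: Balaban1988Convergent, Thm 1 p.262, (1.15) p.249, Cor. 3 (2.50) p.264; Balaban1987RG1, Thm 2 p.259, (0.15) p.254] -/
theorem k1R9Body_false_of_couplingBlind (θ : Stage13HParams F 2) (h : θ.Provisos₁₃SepCoPH F 2) (v : Revision₁₃ F 2 θ h) {Cw : ℝ} (hCw : 0 ≤ Cw)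
    (hw : ∀ (p : B12.RunParams) (j : ℕ), j < p.K →
      -(θ.logz p j) * ((((F.P p.K).L : ℝ) ^ 4 - 1) * sitesCard (F.P p.K) (j + 1)) + θ.Efl p j ≤ Cw * tstarCount (F.P p.K) j)
    (hbody : (θ.ZhUnity F 2 ∧ θ.SlotsNondegenerate₁₃ F 2) ∧ θ.Admissible F 2 ∧ B16.EndStatementBPrinted (Node00.datumOfRecord₁₃SepCoPHV F 2 θ h v).C ∧ (∃ γ₁ : ℝ, 0 < γ₁ ∧ ∀ γ : ℝ, 0 < γ → γ ≤ γ₁ → ∃ P : B12.RunParams, 1 ≤ P.K ∧ ((Node00.datumOfRecord₁₃SepCoPHV F 2 θ h v).C P).flow.InInterval γ P.K) ∧ ∃ (b : ℕ → ℝ) (r γ₀ M : ℝ), 0 < γ₀ ∧ (∀ (n : ℕ) (gs : ℕ → ℝ), FlowStep.RGEqH n (Node00.betaOfRecord₁₃ F 2 θ.toStage13Params) gs → Step.InInterval γ₀ n gs → ∀ k, k ≤ n → |Node00.betaOfRecord₁₃ F 2 θ.toStage13Params k (FlowStep.prefixOf gs k) - b k| ≤ r) ∧ (∀ (n : ℕ)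 (gs : ℕ → ℝ), FlowStep.RGEqH n (Node00.betaOfRecord₁₃ F 2 θ.toStage13Params) gs → Step.InInterval γ₀ n gs → ∀ k, k ≤ n → -M ≤ ∑ j ∈ Finset.Ico k n, Node00.betaOfRecord₁₃ F 2 θ.toStage13Params j (FlowStep.prefixOf gs j)) ∧ ∀ k : ℕ, ContinuousOn (fun x : ℝ => Node00.betaOfRecord₁₃ F 2 θ.toStage13Params k (FlowStep.clampPrefix (Node00.betaOfRecord₁₃ F 2 θ.toStage13Params) γ₀ k x)) {x : ℝ | 0 < x ∧ x ≤ γ₀ ∧ ∀ j, j ≤ k → 1 / γ₀ ^ 2 ≤ FlowStep.Y (Node00.betaOfRecord₁₃ F 2 θ.toStage13Params) γ₀ j x}) : False := by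
  obtain ⟨hU, hθ, hB, hwin, hrows⟩ := hbody
  exact false_of_endStatementBPrinted_of_endpointExistence_of_couplingBlind θ h v le_rfl hCw hw hB
    (endpointGivenRunRowsR13SepCoPHV_holds F θ h v hU hθ hB hrows hwin)

/-- **★★ THE K0-CLASS INSTANCE**: with `θ.logz = 0` and `θ.Efl = 0` (the reading of the tree's Stage-13 inhabitants of record) K1⁹'s body is false at `(θ, h, v)` for EVERY `h`, `v`.
[cite: Balaban1988Convergent, Thm 1 p.262, Cor. 3 (2.50) p.264; Balaban1987RG1, Thm 2 p.259] -/
theorem k1R9Body_false_of_logz_zero_Efl_zero (θ : Stage13HParams F 2) (h : θ.Provisos₁₃SepCoPH F 2) (v : Revision₁₃ F 2 θ h)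
    (hz : ∀ p j, θ.logz p j = 0) (hEfl : ∀ p j, θ.Efl p j = 0)
    (hbody : (θ.ZhUnity F 2 ∧ θ.SlotsNondegenerate₁₃ F 2) ∧ θ.Admissible F 2 ∧ B16.EndStatementBPrinted (Node00.datumOfRecord₁₃SepCoPHV F 2 θ h v).C ∧ (∃ γ₁ : ℝ, 0 < γ₁ ∧ ∀ γ : ℝ, 0 < γ → γ ≤ γ₁ → ∃ P : B12.RunParams, 1 ≤ P.K ∧ ((Node00.datumOfRecord₁₃SepCoPHV F 2 θ h v).C P).flow.InInterval γ P.K) ∧ ∃ (b : ℕ → ℝ) (r γ₀ M : ℝ), 0 < γ₀ ∧ (∀ (n : ℕ) (gs : ℕ → ℝ), FlowStep.RGEqH n (Node00.betaOfRecord₁₃ F 2 θ.toStage13Params) gs → Step.InInterval γ₀ n gs → ∀ k, k ≤ n → |Node00.betaOfRecord₁₃ F 2 θ.toStage13Params k (FlowStep.prefixOf gs k) - b k| ≤ r) ∧ (∀ (n : ℕ) (gs : ℕ → ℝ), FlowStep.RGEqH n (Node00.betaOfRecord₁₃ F 2 θ.toStage13Params) gs → Step.InInterval γ₀ n gs → ∀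 k, k ≤ n → -M ≤ ∑ j ∈ Finset.Ico k n, Node00.betaOfRecord₁₃ F 2 θ.toStage13Params j (FlowStep.prefixOf gs j)) ∧ ∀ k : ℕ, ContinuousOn (fun x : ℝ => Node00.betaOfRecord₁₃ F 2 θ.toStage13Params k (FlowStep.clampPrefix (Node00.betaOfRecord₁₃ F 2 θ.toStage13Params) γ₀ k x)) {x : ℝ | 0 < x ∧ x ≤ γ₀ ∧ ∀ j, j ≤ k → 1 / γ₀ ^ 2 ≤ FlowStep.Y (Node00.betaOfRecord₁₃ F 2 θ.toStage13Params) γ₀ j x}) : False :=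
  k1R9Body_false_of_couplingBlind θ h v (Cw := 0) le_rfl (fun p j _ => by rw [hz, hEfl, neg_zero, zero_mul, zero_add, zero_mul]) hbody

/-- **★★ READING FOR THE SUPPLIER LANES: A K1⁹ WITNESS IS NEVER OF THE K0-CLASS READING.**  If the crux `StabilityBRunRowsAtRecordR13SepCoPHV` holds, then for every family `F` with the
K0⁷ antecedent every witness tuple it yields has `logz` or `Efl` non-zero somewhere — by the previous theorem applied to the witness.  CONDITIONAL on the crux (hypothesis); K1⁹ NOT proved.
[cite: Balaban1988Convergent, Thm 1 p.262, (1.15) p.249; Balaban1987RG1, (0.15) p.254] -/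
theorem k1R9Witness_not_logz_zero_Efl_zero (hK1 : Summit.QuantumFields.YangMills.Theses.BalabanUVNodes.StabilityBRunRowsAtRecordR13SepCoPHV) (F : T4Family)
    (h0 : ∃ θ : Stage13HParams F 2, θ.Provisos₁₃SepCoPH F 2 ∧ (θ.ZhUnity F 2 ∧ θ.SlotsNondegenerate₁₃ F 2) ∧ θ.Admissible F 2) :
    ∃ (θ : Stage13HParams F 2) (h : θ.Provisos₁₃SepCoPH F 2) (v : Revision₁₃ F 2 θ h),
      B16.EndStatementBPrinted (datumOfRecord₁₃SepCoPHV F 2 θ h v).C ∧ ¬ ((∀ p j, θ.logz p j = 0) ∧ (∀ p j, θ.Efl p j = 0)) := by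
  obtain ⟨θ, h, v, hbody⟩ := hK1 F h0
  refine ⟨θ, h, v, hbody.2.2.1, ?_⟩
  rintro ⟨hz, hEfl⟩
  exact k1R9Body_false_of_logz_zero_Efl_zero θ h v hz hEfl hbody

end Summit.QuantumFields.YangMills.BalabanUVNodes.N13K1R9WitnessNotCouplingBlind

end
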